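import Mathlib
import Summits.Ventures.HodgeRepro.Tier4.Line4.Osgood
import Summits.Ventures.HodgeRepro.Tier4.Common.ConcreteAssembly

/-!
# Tier4/Common/CornerHolo — Osgood DISCHARGED: the corner fields are holomorphic; `P_T4` modulo Cartan–Serre alone

Blind re-derivation cell `pub-hodge-repro`, Tier 4 (README §9–§10), seat t4-typer-1 (gen 0).  Target tree path
`lean/Summits/Ventures/HodgeRepro/Tier4/Common/CornerHolo.lean`.  Imports the landed `Tier4/Line4/Osgood.lean`
(seat t4-L4-p1, p662713: `Line4.differentiableOn_pd_ball` — the partial derivatives of a ℂ-differentiable function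
on the ball are holomorphic on the ball, from Mathlib's one-variable Cauchy theory) and typer-1's
`ConcreteAssembly`.

WHAT IS PROVED.  `cornerField_isHolo1`: the corner fields `alb_i^* ω_{i,σ}` are holomorphic on the ball (the
gradient of the holomorphic coordinate of the Albanese lift, component-wise by Osgood); `residual_of'`: the bundle
`ConcreteResidual` from (T2) alone on a relatively compact measurable fundamental domain; **`P_T4_of_concrete''`**:
`P_T4` follows from (P) for the concrete witness of every datum given ONLY (T2) `FiniteDimensional ℂ (HForm)`
(Cartan–Serre) and the existence of a level `Γ′ ≤ Γ` with a relatively compact measurable fundamental domain `D`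
(Godement).

Nothing here says anything about the status of the Hodge conjecture for CM abelian varieties, which is NOT proved
(HC_CM is NOT proved by anyone in this repository).
-/

set_option autoImplicit false

noncomputable section

open Matrix MeasureTheory NumberField Set
open scoped ComplexConjugate ComplexOrder

namespace Summit.Ventures.HodgeRepro.Tier4

open Summit.Ventures.HodgeRepro.Tier4.Common

namespace TargetData

variable {F E : Type} [Field F] [NumberField F] [IsGalois ℚ F] [IsCMField F]
  [Field E] [NumberField E] [IsGalois ℚ E] [IsCMField E] (d : TargetData F E)

/-- **The corner fields are holomorphic on the ball** (Osgood, `Line4.differentiableOn_pd_ball`, component-wise on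
the gradient of the holomorphic coordinate). -/
theorem cornerField_isHolo1 (i : Fin 4) (σ : F →+* ℂ) (hσ : σ ∈ d.T i) : IsHolo1 (d.cornerField i σ hσ) := by
  have hgrad : DifferentiableOn ℂ (grad (d.coord i σ hσ)) ball := by
    refine differentiableOn_pi.2 fun k => ?_
    exact Line4.differentiableOn_pd_ball (d.differentiableOn_coord i σ hσ) k
  exact hgrad.congr fun z hz => d.cornerField_of_mem i σ hσ hz

/-- **The residual bundle from (T2) alone** on a relatively compact measurable fundamental domain. -/
theorem residual_of' {Γ' : Set (Matrix (Fin 3) (Fin 3) E)} (hΓ' : d.IsLevel Γ') {D : Set (Fin 2 → ℂ)}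
    (hDom : d.IsDomain Γ' D) (hDc : closure D ⊆ ball) (hfin : FiniteDimensional ℂ (d.HForm Γ' D)) :
    d.ConcreteResidual Γ' D :=
  d.residual_of hΓ' hDom hDc hfin fun i σ hσ => d.cornerField_isHolo1 i σ hσ

/-- (P) for the concrete witness built from (T2) alone gives the conclusion of `P_T4`. -/
theorem conclusion_of_concrete_P'' {Γ' : Set (Matrix (Fin 3) (Fin 3) E)} (hΓ' : d.IsLevel Γ') {D : Set (Fin 2 → ℂ)}
    (hDom : d.IsDomain Γ' D) (hDc : closure D ⊆ ball) (hfin : FiniteDimensional ℂ (d.HForm Γ' D))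
    (hP : (d.concreteWitness hΓ' hDom.subset_ball hDom.measurableSet (d.residual_of' hΓ' hDom hDc hfin)).P) :
    d.conclusion :=
  d.conclusion_of_concrete_P hΓ' hDom _ hP

end TargetData

/-- **`P_T4` modulo Cartan–Serre**: if every datum has a level `Γ′`, a relatively compact measurable fundamental
domain `D`, the finite-dimensionality of the holomorphic concrete forms of `X_{Γ′}` over `D`, and (P) for the
concrete witness, then `P_T4`. -/
theorem P_T4_of_concrete''
    (h : ∀ (F E : Type) [Field F] [NumberField F] [IsGalois ℚ F] [IsCMField F]
      [Field E] [NumberField E] [IsGalois ℚ E] [IsCMField E] (d : TargetData F E),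
      ∃ (Γ' : Set (Matrix (Fin 3) (Fin 3) E)) (hΓ' : d.IsLevel Γ') (D : Set (Fin 2 → ℂ)) (hDom : d.IsDomain Γ' D)
        (hDc : closure D ⊆ ball) (hfin : FiniteDimensional ℂ (d.HForm Γ' D)),
        (d.concreteWitness hΓ' hDom.subset_ball hDom.measurableSet (d.residual_of' hΓ' hDom hDc hfin)).P) :
    P_T4 := by
  refine P_T4_of_forall fun F E _ _ _ _ _ _ _ _ d => ?_
  obtain ⟨Γ', hΓ', D, hDom, hDc, hfin, hP⟩ := h F E d
  exact d.conclusion_of_concrete_P'' hΓ' hDom hDc hfin hP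

end Summit.Ventures.HodgeRepro.Tier4
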